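import Literature.AlgebraicGeometry.Modules.CechPicSaturatedCover
import HarnessLib

/-!
# A Čech class pulling back to `1` along an open immersion is trivialised on its range

Layer `Literature/AlgebraicGeometry/Modules`, namespace `Literature.AlgebraicGeometry.Modules`.
For an open immersion `ρ : Y ⟶ X` and a unit `1`-cocycle `γ` on `X`:

* `UnitCocycle.descendSec ρ V hV s` — for an open `V ≤ range ρ`, the section `(ρ^♯_V)⁻¹ s ∈ Γ(X, V)` of a section
  `s ∈ Γ(Y, ρ⁻¹ V)` (`ρ^♯_V` is an isomorphism, Mathlib `Scheme.Hom.isIso_app`); multiplicative, compatible with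
  restriction (`descendSec_mul`, `descendSec_one`, `secRes_descendSec`);
* `UnitCocycle.app_g_eq_pullback_g` — the transition functions of the pulled-back cocycle `ρ^* γ`
  (`Modules/UnitCocyclePullback`) read back on `X` are those of `γ`;
* `UnitCocycle.trivOnOfPullbackEqOne` — **if `ρ^* [γ] = 1` in `CechPic Y` then `γ` is trivialised over `range ρ`**
  (`UnitCocycle.TrivOn`, `Modules/CechPicSaturatedCover`): the coboundary `ρ^* γ ∼ 1` on `Y`, its opens moved to `X`
  by `ρ(–)` and its units by `(ρ^♯)⁻¹`;
* `UnitCocycle.TrivOn.ofEq` — transport along an equality of opens.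

This is the step «`𝓛|_{X_U}` trivial for the members `U` of a cover» ⇒ «a `0`-cochain bounding the cocycle on each
`π⁻¹ U`» in the Čech proof that a line bundle trivial on the members of a saturated cover descends
([GortzWedhorn2023, Lemma 24.67], [Hartshorne1977, Ex. III.4.5]); open immersions identify `Y` with the open
subscheme `range ρ` [Hartshorne1977, II §3 (p. 85)].  Everything is proved; no named facts (two definitions with
bodies: `descendSec`, `trivOnOfPullbackEqOne`; one transport `TrivOn.ofEq`).

## References
* [Hartshorne1977] R. Hartshorne, *Algebraic Geometry*, GTM 52 (1977), II §3 (p. 85), III §4 and Ex. III.4.4–4.5.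
* [GortzWedhorn2023] U. Görtz, T. Wedhorn, *Algebraic Geometry II: Cohomology of Schemes* (2023), Lemma 24.67 (p. 406).
-/

noncomputable section

-- `TopCat.Presheaf` / `Scheme.Modules` are not reducible (as in Mathlib's `AlgebraicGeometry/Modules/Sheaf.lean`).
set_option backward.isDefEq.respectTransparency false

open CategoryTheory AlgebraicGeometry Opposite TopologicalSpace

namespace Literature.AlgebraicGeometry.Modules

universe u

variable {X Y : Scheme.{u}} (ρ : Y ⟶ X) [IsOpenImmersion ρ]

namespace UnitCocycle

/-- Descent of a section along an open immersion over an open inside its range: `(ρ^♯_V)⁻¹ s`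
(`ρ^♯_V` is an isomorphism for `V ≤ range ρ`, Mathlib `Scheme.Hom.isIso_app`). Non-Prop plumbing. [folklore] -/
def descendSec (V : X.Opens) (hV : V ≤ ρ.opensRange) (s : Γ(Y, ρ ⁻¹ᵁ V)) : Γ(X, V) :=
  haveI := ρ.isIso_app V hV
  (CategoryTheory.inv (ρ.app V)).hom s

/-- `ρ^♯ ((ρ^♯)⁻¹ s) = s`. [cite: Hartshorne1977, II §3 (p. 85)] -/
theorem app_descendSec (V : X.Opens) (hV : V ≤ ρ.opensRange) (s : Γ(Y, ρ ⁻¹ᵁ V)) :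
    ρ.app V (descendSec ρ V hV s) = s := by
  haveI := ρ.isIso_app V hV
  change (CategoryTheory.inv (ρ.app V) ≫ ρ.app V).hom s = s
  rw [IsIso.inv_hom_id]
  rfl

/-- `ρ^♯_V` is injective for `V ≤ range ρ`. [cite: Hartshorne1977, II §3 (p. 85)] -/
theorem app_injective (V : X.Opens) (hV : V ≤ ρ.opensRange) : Function.Injective (ρ.app V) := by
  haveI := ρ.isIso_app V hV
  exact (ConcreteCategory.bijective_of_isIso (ρ.app V)).1

/-- `descendSec` is a ring homomorphism: products. [cite: Hartshorne1977, II §3 (p. 85)] -/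
theorem descendSec_mul (V : X.Opens) (hV : V ≤ ρ.opensRange) (s s' : Γ(Y, ρ ⁻¹ᵁ V)) :
    descendSec ρ V hV (s * s') = descendSec ρ V hV s * descendSec ρ V hV s' := by
  unfold descendSec
  exact map_mul _ _ _

/-- `descendSec` is a ring homomorphism: one. [cite: Hartshorne1977, II §3 (p. 85)] -/
theorem descendSec_one (V : X.Opens) (hV : V ≤ ρ.opensRange) : descendSec ρ V hV 1 = 1 := by
  unfold descendSec
  exact map_one _

/-- `descendSec` commutes with restriction. [cite: Hartshorne1977, II §3 (p. 85)] -/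
theorem secRes_descendSec {V V' : X.Opens} (hV : V ≤ ρ.opensRange) (i : V' ≤ V) (s : Γ(Y, ρ ⁻¹ᵁ V)) :
    secRes X i (descendSec ρ V hV s) = descendSec ρ V' (i.trans hV) (secRes Y (ρ.preimage_mono i) s) := by
  apply app_injective ρ V' (i.trans hV)
  rw [app_descendSec, app_secRes, app_descendSec]

variable {ρ}

/-- For `V ≤ ρ(W)`: `ρ⁻¹ V ≤ W`. [cite: Hartshorne1977, II §3 (p. 85)] -/
theorem preimage_le_of_le_image {V : X.Opens} {W : Y.Opens} (h : V ≤ ρ ''ᵁ W) : ρ ⁻¹ᵁ V ≤ W :=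
  (ρ.preimage_mono h).trans_eq (ρ.preimage_image_eq W)

variable (γ : UnitCocycle X)

omit [IsOpenImmersion ρ] in
/-- The key local computation, with the point of `X` GENERALISED (so that `ρ y = z` can be substituted):
the pulled-back transition function read back on `X` is the transition function.
`ρ^♯_V (γ_{z z'}|_V) = (ρ^*γ)_{y y'}|_{ρ⁻¹V}` for `ρ y = z`, `ρ y' = z'`. [cite: Hartshorne1977, III §4 and Ex. III.4.4] -/
theorem app_g_eq_pullback_g {y y' : Y} {z z' : X} (hz : ρ.base y = z) (hz' : ρ.base y' = z') (V : X.Opens)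
    (hVz : V ≤ γ.U z) (hVz' : V ≤ γ.U z') (hy : ρ ⁻¹ᵁ V ≤ (pullback ρ γ).U y) (hy' : ρ ⁻¹ᵁ V ≤ (pullback ρ γ).U y') :
    ρ.app V (γ.g z z' V hVz hVz') = (pullback ρ γ).g y y' (ρ ⁻¹ᵁ V) hy hy' := by
  subst hz hz'
  rw [pullback_g, ← γ.map_g _ _ (inf_le_left : γ.U (ρ.base y) ⊓ γ.U (ρ.base y') ≤ _) inf_le_right (le_inf hVz hVz'),
    app_secRes, Scheme.Hom.app_eq_appLE, secRes_appLE]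

/-- **A trivialisation of `γ` over the range of an open immersion `ρ` from `ρ^*[γ] = 1`**: the coboundary of
`ρ^*γ ~ 1` on `Y`, with its opens moved to `X` by `ρ(–)` and its sections by `(ρ^♯)⁻¹`.
[cite: Hartshorne1977, III §4 and Ex. III.4.4] -/
def trivOnOfPullbackEqOne (h : CechPic.pullback ρ (CechPic.mk γ) = 1) : γ.TrivOn ρ.opensRange :=
  -- the coboundary on `Y`
  have hb : Nonempty (Coboundary (pullback ρ γ) (one Y)) :=
    (CechPic.mk_eq_mk_iff _ _).1 ((CechPic.pullback_mk ρ γ).symm.trans (h.trans CechPic.mk_one.symm))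
  let b : Coboundary (pullback ρ γ) (one Y) := Classical.choice hb
  -- a point of `Y` over each point of the range
  let y : ρ.opensRange → Y := fun z => (Scheme.Hom.mem_opensRange.1 z.2).choose
  have hy : ∀ z : ρ.opensRange, ρ.base (y z) = z := fun z => (Scheme.Hom.mem_opensRange.1 z.2).choose_spec
  { W := fun z => ρ ''ᵁ b.W (y z)
    mem := fun z => by
      have h1 : ρ.base (y z) ∈ ρ ''ᵁ b.W (y z) := (ρ.apply_mem_image_iff).2 (b.mem (y z))
      rwa [hy z] at h1
    le := fun z => ρ.image_le_opensRange _
    leU := fun z => by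
      have h1 : ρ ''ᵁ b.W (y z) ≤ γ.U (ρ.base (y z)) :=
        (ρ.image_mono (b.le (y z))).trans (ρ.image_preimage_le _)
      rwa [hy z] at h1
    lam := fun z V hV => descendSec ρ V (hV.trans (ρ.image_le_opensRange _))
      (b.lam (y z) (ρ ⁻¹ᵁ V) (preimage_le_of_le_image hV))
    inv := fun z V hV => descendSec ρ V (hV.trans (ρ.image_le_opensRange _))
      (b.inv (y z) (ρ ⁻¹ᵁ V) (preimage_le_of_le_image hV))
    map_lam := fun z V V' hV i => by
      rw [secRes_descendSec, b.map_lam]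
    lam_mul_inv := fun z V hV => by
      rw [← descendSec_mul, b.lam_mul_inv, descendSec_one]
    rel := fun z z' V hz hz' => by
      apply app_injective ρ V (hz.trans (ρ.image_le_opensRange _))
      rw [app_descendSec, map_mul, app_descendSec,
        app_g_eq_pullback_g γ (hy z) (hy z') V _ _ ((preimage_le_of_le_image hz).trans (b.le _))
          ((preimage_le_of_le_image hz').trans (b.le _))]
      have r := b.rel (y z) (y z') (ρ ⁻¹ᵁ V) (preimage_le_of_le_image hz) (preimage_le_of_le_image hz')
      rw [show (one Y).g (y z) (y z') (ρ ⁻¹ᵁ V) ((preimage_le_of_le_image hz).trans (b.le' _))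
          ((preimage_le_of_le_image hz').trans (b.le' _)) = 1 from rfl, one_mul] at r
      exact r }

/-- Transport of a trivialisation along an equality of opens. [folklore] -/
def TrivOn.ofEq {R R' : X.Opens} (t : γ.TrivOn R) (h : R = R') : γ.TrivOn R' := h ▸ t

end UnitCocycle

end Literature.AlgebraicGeometry.Modules

end
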